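import Literature.NumberTheory.EllipticCurves.Rank1Residual.Typed.X5DescentLevel3Witness
import HarnessLib

/-!
# X5 (p = 2): the descent datum at ANY level from ONE pairing bit — the uniform item form

Support file for the BSD rank-≤ 1 residual programme, class X5 (`p = 2`), unit `b2b-bsdres-sha-1`
(gen 6). Honest framing: prove what is provable now; shrink each hard class to its core with data;
no claim beyond stated classes. Everything here is proved; the named facts entering the consumers
are Gross–Zagier–Kolyvagin (`hGZK`) and, for the witness form, the Cassels–Tate pairing bsd.S18
(`hCT`). Nothing is claimed for any curve.

`X5DescentPairing` (level 2, engines G / H) and `X5DescentLevel3Witness` (level 3, the OPEN input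
of 19074h1/h2) prove the same mechanism at two levels. This file states it ONCE, uniformly in the
level, for the whole `#Ш[2] = 4` part of the census (every X5-core curve; `Ш[2] ≅ (ℤ/2)²`):

* `card_torsionBy_two_pow_succ_of_two_divisible` — `#A[2^(k+1)] = #A[2] · #A[2^k]` when
  `A[2^k] ⊆ 2A` (doubling maps `A[2^(k+1)]` onto `A[2^k]` with kernel `A[2]`); hence
  `card_torsionBy_two_pow_of_two_divisible`: `#A[2] = 4`, `A[2^k] ⊆ 2A` ⟹ `#A[2^(k+1)] = 4^(k+1)`;
* `stable_two_pow_of_pairing_bit` — for ANY alternating bi-additive `B` on `A` with `#A[2] = 4` and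
  `A[2^k] ⊆ 2A`: ONE `x ∈ A[2^(k+1)]`, `y ∈ A[2]` with `B x y ≠ 0` forces `A[2^(k+2)] = A[2^(k+1)]`
  (structure-free four-element case analysis; `k = 0`: a non-zero Cassels–Tate value on
  `Sel^(2) × Sel^(2)` gives `Ш[4] = Ш[2]`; `k = 1`: engine G / H; `k = 2`: the 19074h datum);
  `stable_two_pow_of_witness` — the same from ONE non-divisible `x ∈ A[2^(k+1)]` given the
  orthogonality property (Cassels–Tate kernel);
* `X5.descentCertificateAt_of_pairing_bit`, `X5.bsdp_two_of_pairing_bit`,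
  `X5.bsdp_two_of_casselsTate_witness_level` — WHICH CERTIFIED DATA DISCHARGE `X5.MissingInputAt W 2`
  for a curve with `#Ш[2] = 4`, uniformly: the lifting line `Ш[2^k] ⊆ 2Ш` (every `2^k`-Selmer
  class lifts one level), ONE pairing bit at level `(2^(k+1), 2)` (or one non-divisible element of
  `Ш[2^(k+1)]` + bsd.S18), and `ord₂ #Ш_an = 2(k+1)`; granted GZK this is `BSD(E, 2)`.

References: Silverman, *AEC* (2009), Thm. X.4.2, Thm. X.4.14; Cassels (1962), Arithmetic IV;
Cassels (1998), §1; Merriman–Siksek–Smart (1996), §4; Stamminger (2005), Thm. 6.2.2.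
-/

noncomputable section

open scoped Classical
open scoped AddSubgroup

open WeierstrassCurve Literature.NumberTheory.EllipticCurves
  Literature.NumberTheory.EllipticCurves.Rank1Residual
  Literature.GroupTheory.FiniteAbelian

namespace Literature.NumberTheory.EllipticCurves.Rank1Residual.Typed

/-! ### §1 Algebra, uniformly in the level -/

section Algebra

variable {A : Type*} [AddCommGroup A] {Q : Type*} [AddCommGroup Q] (B : A →+ A →+ Q)

omit B in
/-- `2^(k+1) • x = 2^k • (2 • x)` (content-free private helper). [folklore] -/
private theorem two_pow_succ_smul (k : ℕ) (x : A) : 2 ^ (k + 1) • x = 2 ^ k • (2 • x) := by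
  rw [smul_smul, pow_succ]

omit B in
/-- `2^(k+1) • x = 2 • (2^k • x)` (content-free private helper). [folklore] -/
private theorem two_pow_succ_smul' (k : ℕ) (x : A) : 2 ^ (k + 1) • x = 2 • (2 ^ k • x) := by
  rw [smul_smul, pow_succ']

omit B in
/-- **`#A[2^(k+1)] = #A[2] · #A[2^k]` when every element of `A[2^k]` is twice an element**:
multiplication by `2` maps `A[2^(k+1)]` ONTO `A[2^k]` with kernel `A[2]`. The cases `k = 1, 2` are
`card_torsionBy_four_of_two_divisible`, `card_torsionBy_eight_of_two_divisible_four`.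
[cite: MerrimanSiksekSmart1996, §4] [cite: SilvermanAEC2009, Thm X.4.2(a)] -/
theorem card_torsionBy_two_pow_succ_of_two_divisible {k n m : ℕ}
    (h2 : Nat.card (A[(2 : ℕ)]) = n) (hk : Nat.card (A[(2 ^ k : ℕ)]) = m)
    (hdiv : ∀ y : A, 2 ^ k • y = 0 → ∃ x : A, 2 • x = y) :
    Nat.card (A[(2 ^ (k + 1) : ℕ)]) = n * m := by
  -- the doubling map on `A[2^(k+1)]`
  let f : A[(2 ^ (k + 1) : ℕ)] →+ A := (nsmulAddMonoidHom 2).comp (A[(2 ^ (k + 1) : ℕ)]).subtype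
  have hf : ∀ x : A[(2 ^ (k + 1) : ℕ)], f x = 2 • (x : A) := fun x => rfl
  have hmemS : ∀ x : A, x ∈ A[(2 ^ (k + 1) : ℕ)] ↔ 2 ^ (k + 1) • x = 0 := fun x =>
    AddSubgroup.torsionBy.nsmul_iff (n := 2 ^ (k + 1))
  have hmemk : ∀ x : A, x ∈ A[(2 ^ k : ℕ)] ↔ 2 ^ k • x = 0 := fun x =>
    AddSubgroup.torsionBy.nsmul_iff (n := 2 ^ k)
  have hmem2 : ∀ x : A, x ∈ A[(2 : ℕ)] ↔ 2 • x = 0 := fun x =>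
    AddSubgroup.torsionBy.nsmul_iff (n := 2)
  -- its range is `A[2^k]`
  have hrange : f.range = A[(2 ^ k : ℕ)] := by
    ext y
    rw [AddMonoidHom.mem_range, hmemk]
    constructor
    · rintro ⟨x, rfl⟩
      rw [hf, ← two_pow_succ_smul]
      exact (hmemS x).1 x.2
    · intro hy
      obtain ⟨x, rfl⟩ := hdiv y hy
      exact ⟨⟨x, (hmemS x).2 (by rw [two_pow_succ_smul]; exact hy)⟩, rfl⟩
  -- its kernel is `A[2]` seen inside `A[2^(k+1)]`
  have hle : A[(2 : ℕ)] ≤ A[(2 ^ (k + 1) : ℕ)] := by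
    intro x hx
    rw [hmem2] at hx
    rw [hmemS, two_pow_succ_smul, hx, smul_zero]
  have hker : f.ker = (A[(2 : ℕ)]).addSubgroupOf (A[(2 ^ (k + 1) : ℕ)]) := by
    ext x
    rw [AddMonoidHom.mem_ker, AddSubgroup.mem_addSubgroupOf, hmem2, hf]
  have hcker : Nat.card f.ker = n := by
    rw [hker, Nat.card_congr (AddSubgroup.addSubgroupOfEquivOfLe hle).toEquiv, h2]
  have hcrange : Nat.card f.range = m := by rw [hrange, hk]
  have hmul := f.ker.card_mul_index
  rw [AddSubgroup.index_ker, hcker, hcrange] at hmul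
  exact hmul.symm

omit B in
/-- **The count line, uniformly**: `#A[2] = 4` and `A[2^k] ⊆ 2A` ⟹ `#A[2^(k+1)] = 4^(k+1)`
(induction on the level: `A[2^j] ⊆ A[2^k] ⊆ 2A` for `j ≤ k`). [cite: MerrimanSiksekSmart1996, §4] -/
theorem card_torsionBy_two_pow_of_two_divisible {k : ℕ} (h2 : Nat.card (A[(2 : ℕ)]) = 4)
    (hdiv : ∀ y : A, 2 ^ k • y = 0 → ∃ x : A, 2 • x = y) :
    Nat.card (A[(2 ^ (k + 1) : ℕ)]) = 4 ^ (k + 1) := by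
  induction k with
  | zero => simpa using h2
  | succ k ih =>
    -- `A[2^k] ⊆ A[2^(k+1)] ⊆ 2A`
    have hdiv' : ∀ y : A, 2 ^ k • y = 0 → ∃ x : A, 2 • x = y := fun y hy =>
      hdiv y (by rw [two_pow_succ_smul', hy, smul_zero])
    rw [card_torsionBy_two_pow_succ_of_two_divisible h2 (ih hdiv') hdiv, pow_succ' 4 (k + 1)]

omit B in
/-- **A homomorphism killing two distinct non-zero elements of a four-element `A[2]` kills `A[2]`**
(`A[2] = {0, a, b, a + b}`). Public copy of the private helper of `X5DescentLevel3Witness`.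
[cite: SilvermanAEC2009, Thm. X.4.14 (bilinearity is all that is used downstream)] -/
theorem eq_zero_on_torsionBy_two_of_card_four (hcard : Nat.card (A[(2 : ℕ)]) = 4) (f : A →+ Q)
    {a b : A} (ha : 2 • a = 0) (hb : 2 • b = 0) (ha0 : a ≠ 0) (hb0 : b ≠ 0) (hab : a ≠ b)
    (hfa : f a = 0) (hfb : f b = 0) : ∀ v : A, 2 • v = 0 → f v = 0 := by
  intro v hv
  haveI : Finite (A[(2 : ℕ)]) := Nat.finite_of_card_ne_zero (by rw [hcard]; norm_num)
  haveI : Fintype (A[(2 : ℕ)]) := Fintype.ofFinite _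
  have hmem : ∀ {x : A}, 2 • x = 0 → x ∈ A[(2 : ℕ)] := fun hx => AddSubgroup.torsionBy.nsmul_iff.2 hx
  let a' : A[(2 : ℕ)] := ⟨a, hmem ha⟩
  let b' : A[(2 : ℕ)] := ⟨b, hmem hb⟩
  let v' : A[(2 : ℕ)] := ⟨v, hmem hv⟩
  have hab' : a' + b' = ⟨a + b, hmem (by rw [smul_add, ha, hb, add_zero])⟩ := rfl
  have hnegb : -b = b := by
    rw [neg_eq_iff_add_eq_zero, ← two_nsmul]; exact hb
  have h1 : a + b ≠ 0 := by
    intro h; apply hab; rw [add_eq_zero_iff_eq_neg.1 h, hnegb]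
  have h2 : a + b ≠ a := by
    intro h; exact hb0 (by simpa using h)
  have h3 : a + b ≠ b := by
    intro h; exact ha0 (by simpa using h)
  -- the four-element finset `{0, a, b, a + b}` is all of `A[2]`
  let S : Finset (A[(2 : ℕ)]) := {0, a', b', a' + b'}
  have hS : S.card = 4 := by
    have e0a : (0 : A[(2 : ℕ)]) ≠ a' := fun h => ha0 (congrArg Subtype.val h).symm
    have e0b : (0 : A[(2 : ℕ)]) ≠ b' := fun h => hb0 (congrArg Subtype.val h).symm
    have e0c : (0 : A[(2 : ℕ)]) ≠ a' + b' := fun h =>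
      h1 (by rw [hab'] at h; exact (congrArg Subtype.val h).symm)
    have eab : a' ≠ b' := fun h => hab (congrArg Subtype.val h)
    have eac : a' ≠ a' + b' := fun h =>
      h2 (by rw [hab'] at h; exact (congrArg Subtype.val h).symm)
    have ebc : b' ≠ a' + b' := fun h =>
      h3 (by rw [hab'] at h; exact (congrArg Subtype.val h).symm)
    simp only [S]
    rw [Finset.card_insert_of_notMem, Finset.card_insert_of_notMem, Finset.card_insert_of_notMem,
      Finset.card_singleton]
    · simpa using ebc
    · simp only [Finset.mem_insert, Finset.mem_singleton, not_or]; exact ⟨eab, eac⟩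
    · simp only [Finset.mem_insert, Finset.mem_singleton, not_or]; exact ⟨e0a, e0b, e0c⟩
  have hcard' : Fintype.card (A[(2 : ℕ)]) = 4 := by rw [← Nat.card_eq_fintype_card, hcard]
  have hSuniv : S = Finset.univ := Finset.eq_univ_of_card S (by rw [hS, hcard'])
  have hvS : v' ∈ S := by rw [hSuniv]; exact Finset.mem_univ _
  simp only [S, Finset.mem_insert, Finset.mem_singleton] at hvS
  have hfab : f (a + b) = 0 := by rw [map_add, hfa, hfb, add_zero]
  rcases hvS with h | h | h | h
  · have hv0 : v = 0 := by simpa [v'] using congrArg Subtype.val h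
    rw [hv0, map_zero]
  · have hva : v = a := by simpa [v', a'] using congrArg Subtype.val h
    rw [hva, hfa]
  · have hvb : v = b := by simpa [v', b'] using congrArg Subtype.val h
    rw [hvb, hfb]
  · have hvab : v = a + b := by rw [hab'] at h; simpa [v'] using congrArg Subtype.val h
    rw [hvab, hfab]

/-- **ONE pairing bit at level `(2^(k+1), 2)` IS `A[2^(k+2)] = A[2^(k+1)]`, structure-free and
uniform in `k`.** For ANY alternating bi-additive `B : A × A → Q`: if `#A[2] = 4`, every element of
`A[2^k]` is twice an element (`hdiv`), and ONE `x ∈ A[2^(k+1)]` pairs non-trivially with ONE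
`y ∈ A[2]`, then `2^(k+2) z = 0 ⇒ 2^(k+1) z = 0`. Proof: `x ∉ 2A` (bilinearity), so `2^k x ≠ 0`; if
`2^(k+1) z ≠ 0` then either `2^k x = 2^(k+1) z`, whence `x - 2z ∈ A[2^k] ⊆ 2A` and `x ∈ 2A`; or
`2^k x, 2^(k+1) z` are distinct non-zero elements of the four-element `A[2]`, both killed by `B x`
(`B x (2^k x) = 2^k·B x x = 0`, `B x (2^(k+1) z) = B (2^(k+1) x) z = 0`), so `B x` kills `A[2] ∋ y`.
Levels: `k = 0` (`A[4] = A[2]` from a non-zero value on `A[2] × A[2]`), `k = 1`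
(`stable_four_of_pairing_bits` / `…_witness`), `k = 2` (`stable_eight_of_pairing_bit`).
[cite: SilvermanAEC2009, Thm. X.4.14 (bilinear, alternating)] [cite: Cassels1998, §1] -/
theorem stable_two_pow_of_pairing_bit {k : ℕ} (halt : ∀ x : A, B x x = 0)
    (hcard : Nat.card (A[(2 : ℕ)]) = 4) (hdiv : ∀ y : A, 2 ^ k • y = 0 → ∃ x : A, 2 • x = y)
    (hbit : ∃ x y : A, 2 ^ (k + 1) • x = 0 ∧ 2 • y = 0 ∧ B x y ≠ 0) :
    ∀ z : A, 2 ^ (k + 2) • z = 0 → 2 ^ (k + 1) • z = 0 := by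
  obtain ⟨x, y, hx, hy, hB⟩ := hbit
  have hx2 : ¬ ∃ u : A, 2 • u = x := not_two_divisible_of_pairing_bit B hy hB
  have hkx : 2 ^ k • x ≠ 0 := fun h => hx2 (hdiv x h)
  intro z hz
  by_contra hne
  by_cases hxw : 2 ^ k • x = 2 ^ (k + 1) • z
  · -- `x - 2z ∈ A[2^k] ⊆ 2A`, so `x ∈ 2A`
    have hk0 : 2 ^ k • (x - 2 • z) = 0 := by
      rw [smul_sub, hxw, ← two_pow_succ_smul, sub_self]
    obtain ⟨u, hu⟩ := hdiv _ hk0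
    exact hx2 ⟨u + z, by rw [smul_add, hu, sub_add_cancel]⟩
  · -- `2^k x ≠ 2^(k+1) z`, both non-zero in the four-element `A[2]`, both killed by `B x`
    have h2a : 2 • (2 ^ k • x) = 0 := by rw [← two_pow_succ_smul']; exact hx
    have h2b : 2 • (2 ^ (k + 1) • z) = 0 := by rw [← two_pow_succ_smul']; exact hz
    have hBa : B x (2 ^ k • x) = 0 := by rw [map_nsmul, halt, smul_zero]
    have hBb : B x (2 ^ (k + 1) • z) = 0 := by
      have e : B x (2 ^ (k + 1) • z) = B (2 ^ (k + 1) • x) z := by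
        simp only [map_nsmul, AddMonoidHom.nsmul_apply]
      rw [e, hx, map_zero, AddMonoidHom.zero_apply]
    -- `B x` kills two distinct non-zero elements of the four-element `A[2]`, hence `A[2] ∋ y`
    exact hB (eq_zero_on_torsionBy_two_of_card_four hcard (B x) h2a h2b hkx hne hxw hBa hBb y hy)

/-- **Witness form, uniform in the level**: with the ORTHOGONALITY property (`horth`: an element
pairing trivially with `A[2]` is twice an element — the Cassels–Tate kernel property on a finite
`Ш`), ONE `x ∈ A[2^(k+1)]` that is not twice an element gives the bit, hence
`A[2^(k+2)] = A[2^(k+1)]`. [cite: SilvermanAEC2009, Thm. X.4.14] [cite: Cassels1962ArithmeticIV, Thm. 1.1] -/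
theorem stable_two_pow_of_witness {k : ℕ} (halt : ∀ x : A, B x x = 0)
    (horth : ∀ x : A, (∀ y : A, 2 • y = 0 → B x y = 0) → ∃ w : A, 2 • w = x)
    (hcard : Nat.card (A[(2 : ℕ)]) = 4) (hdiv : ∀ y : A, 2 ^ k • y = 0 → ∃ x : A, 2 • x = y)
    (hx : ∃ x : A, 2 ^ (k + 1) • x = 0 ∧ ¬ ∃ w : A, 2 • w = x) :
    ∀ z : A, 2 ^ (k + 2) • z = 0 → 2 ^ (k + 1) • z = 0 := by
  obtain ⟨x, hxk, hx2⟩ := hx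
  refine stable_two_pow_of_pairing_bit B halt hcard hdiv ?_
  by_contra h
  exact hx2 (horth x fun y hy => Classical.by_contradiction fun hB => h ⟨x, y, hxk, hy, hB⟩)

end Algebra

/-! ### §2 `Ш(E/ℚ)`: which certified data discharge `X5.MissingInputAt W 2`, uniformly -/

section Sha

variable (W : WeierstrassCurve ℚ) [W.IsElliptic] [W.IsGloballyMinimal]

omit [W.IsElliptic] [W.IsGloballyMinimal] in
/-- **THE UNIFORM DATUM (pairing-bit shape, structure-free).** For a curve with `#Ш[2] = 4`: the
lifting line `Ш[2^k] ⊆ 2Ш`, ANY alternating bi-additive `B` on `Ш(E/ℚ)` with ONE `x ∈ Ш[2^(k+1)]`,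
`y ∈ Ш[2]`, `B x y ≠ 0`, and `ord₂ #Ш_an = 2(k+1)` give the X5 descent certificate (at level
`k + 1`, `#Ш[2^(k+1)] = 4^(k+1)`, `Ш[2^(k+2)] = Ш[2^(k+1)]`). Levels `k = 0, 1, 2` = sharp rows,
engines G / H, the 19074h datum. Nothing is claimed for any curve.
[cite: SilvermanAEC2009, Thm. X.4.2(a), Thm. X.4.14] [cite: Cassels1998, §1] [cite: Miller2011LMS, Def. 1.1] -/
theorem X5.descentCertificateAt_of_pairing_bit {k : ℕ} {Q : Type*} [AddCommGroup Q]
    (B : W.sha →+ W.sha →+ Q) (halt : ∀ x : W.sha, B x x = 0)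
    (h2 : Nat.card (AddSubgroup.torsionBy W.sha 2) = 4)
    (hdiv : ∀ y : W.sha, 2 ^ k • y = 0 → ∃ x : W.sha, 2 • x = y)
    (hbit : ∃ x y : W.sha, 2 ^ (k + 1) • x = 0 ∧ 2 • y = 0 ∧ B x y ≠ 0)
    {q : ℚ} (hq : shaAn W = (q : ℂ)) (hv : padicValRat 2 q = ((2 * (k + 1) : ℕ) : ℤ)) :
    X5.DescentCertificateAt W := by
  have h2' : Nat.card ((W.sha)[(2 : ℕ)]) = 4 := by simpa using h2
  have hcard : Nat.card (AddSubgroup.torsionBy W.sha (2 ^ (k + 1) : ℕ)) = 2 ^ (2 * (k + 1)) := by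
    rw [card_torsionBy_two_pow_of_two_divisible h2' hdiv, pow_mul]; norm_num
  exact X5.descentCertificateAt_of_level W (k := k + 1) (m := 2 * (k + 1))
    (stable_two_pow_of_pairing_bit B halt h2' hdiv hbit) hcard hq hv

/-- **X5, ANY level, pairing-bit shape: `BSD(E, 2)` from ONE bit** (granted GZK `hGZK`;
`r_an ≤ 1`). Supersedes, uniformly in `k`, `X5.bsdp_two_of_casselsTate_bits` (`k = 1`) and
`X5.bsdp_two_of_pairing_bit₈` (`k = 2`). Nothing is claimed for any curve.
[cite: SilvermanAEC2009, Thm. X.4.2(a), Thm. X.4.14] [cite: Cassels1998, §1] [cite: Miller2011LMS, Def. 1.1] -/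
theorem X5.bsdp_two_of_pairing_bit {k : ℕ} (hGZK : rank_eq_analyticRank_of_analyticRank_le_one)
    (hr : W.analyticRank ≤ 1) {Q : Type*} [AddCommGroup Q] (B : W.sha →+ W.sha →+ Q)
    (halt : ∀ x : W.sha, B x x = 0) (h2 : Nat.card (AddSubgroup.torsionBy W.sha 2) = 4)
    (hdiv : ∀ y : W.sha, 2 ^ k • y = 0 → ∃ x : W.sha, 2 • x = y)
    (hbit : ∃ x y : W.sha, 2 ^ (k + 1) • x = 0 ∧ 2 • y = 0 ∧ B x y ≠ 0)
    {q : ℚ} (hq : shaAn W = (q : ℂ)) (hv : padicValRat 2 q = ((2 * (k + 1) : ℕ) : ℤ)) :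
    BSDp W 2 :=
  X5.bsdp_two_of_descentCertificateAt W hGZK hr
    (X5.descentCertificateAt_of_pairing_bit W B halt h2 hdiv hbit hq hv)

/-- **X5, ANY level, witness shape: `BSD(E, 2)` from ONE non-divisible element of `Ш[2^(k+1)]` and
bsd.S18** (GZK `hGZK`: `Ш` finite; the Cassels–Tate named fact `hCT`; `r_an ≤ 1`; `#Ш[2] = 4`;
`Ш[2^k] ⊆ 2Ш`; ONE `x ∈ Ш[2^(k+1)]` not twice an element; `ord₂ #Ш_an = 2(k+1)`). For `k = 0` this
reads: ONE element of `Ш[2]` outside `2Ш` already forces `Ш[4] = Ш[2]` when `#Ш[2] = 4` (the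
Cassels–Tate rank on `Ш[2]/(Ш[2] ∩ 2Ш)` is even). Nothing is claimed for any curve.
[cite: SilvermanAEC2009, Thm. X.4.14] [cite: Cassels1962ArithmeticIV, Thm. 1.1] [cite: Miller2011LMS, Def. 1.1] -/
theorem X5.bsdp_two_of_casselsTate_witness_level {k : ℕ}
    (hGZK : rank_eq_analyticRank_of_analyticRank_le_one)
    (hCT : WeierstrassCurve.exists_casselsTate_pairing (K := ℚ)) (hr : W.analyticRank ≤ 1)
    (h2 : Nat.card (AddSubgroup.torsionBy W.sha 2) = 4)
    (hdiv : ∀ y : W.sha, 2 ^ k • y = 0 → ∃ x : W.sha, 2 • x = y)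
    (hx : ∃ x : W.sha, 2 ^ (k + 1) • x = 0 ∧ ¬ ∃ w : W.sha, 2 • w = x)
    {q : ℚ} (hq : shaAn W = (q : ℂ)) (hv : padicValRat 2 q = ((2 * (k + 1) : ℕ) : ℤ)) :
    BSDp W 2 := by
  haveI : Finite W.sha := (hGZK W hr).2
  obtain ⟨B, halt, horth⟩ := sha_orthogonal_two_of_casselsTate W hCT
  obtain ⟨x, hxk, hx2⟩ := hx
  have hbit : ∃ x y : W.sha, 2 ^ (k + 1) • x = 0 ∧ 2 • y = 0 ∧ B x y ≠ 0 := by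
    by_contra h
    exact hx2 (horth x fun y hy => Classical.by_contradiction fun hB => h ⟨x, y, hxk, hy, hB⟩)
  exact X5.bsdp_two_of_pairing_bit W hGZK hr B halt h2 hdiv hbit hq hv

/-! ### §3 Over the tree's Selmer groups `Sel^(2^j)(E/ℚ)`, uniformly -/

/-- Arithmetic side condition `2^(k+1) ∣ 2^k · 2` for `[2]_* : Sel^(2^(k+1)) → Sel^(2^k)`
(content-free; the divisibility `n ∣ d·m` required by `selmerZSMul`, Silverman's `[m]`-map between
Selmer groups). [cite: SilvermanAEC2009, X.§4 (proof of X.4.2)] -/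
theorem two_pow_succ_dvd_mul_two (k : ℕ) : ((2 ^ (k + 1) : ℕ) : ℤ) ∣ ((2 ^ k : ℕ) : ℤ) * 2 := by
  push_cast
  exact dvd_of_eq (pow_succ 2 k)

omit [W.IsElliptic] [W.IsGloballyMinimal] in
/-- **Every `2^k`-Selmer class lifts to a `2^(k+1)`-Selmer class ⟹ `Ш[2^k] ⊆ 2Ш`**
(`Sel^(2^k) ↠ Ш[2^k]`, `π ([2]_* z) = 2·π'(z)`); levels `k = 1, 2` are
`X5.two_divisible_of_selmer_lift`, `X5.four_torsion_two_divisible_of_selmer_lift₄`.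
[cite: Cassels1998, §1; SilvermanAEC2009, Thm. X.4.2(a)] -/
theorem X5.two_divisible_of_selmer_lift_level {k : ℕ}
    (hF : ∀ s : W.selmerGroup (2 ^ k : ℕ), ∃ z : W.selmerGroup (2 ^ (k + 1) : ℕ),
      W.selmerZSMul 2 (two_pow_succ_dvd_mul_two k) z = s) :
    ∀ y : W.sha, 2 ^ k • y = 0 → ∃ x : W.sha, 2 • x = y := by
  intro y hy
  obtain ⟨s, rfl⟩ := W.exists_selmerToSha_eq (n := ((2 ^ k : ℕ) : ℤ)) (by positivity) y
    (by rw [Nat.cast_smul_eq_nsmul]; exact hy)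
  obtain ⟨z, rfl⟩ := hF s
  exact ⟨W.selmerToSha _ z, by rw [selmerToSha_selmerZSMul, ofNat_zsmul]⟩

omit [W.IsGloballyMinimal] in
/-- **ITEM FORM at levels `2^(k+1) | 2^(k+2)`, the load-bearing direction**: a `2^(k+1)`-Selmer
class `s` NOT in `[2]_* Sel^(2^(k+2))(E/ℚ)` has torsor class `π(s)` NOT divisible by `2` in
`Ш(E/ℚ)` (Kummer–Selmer diagram: `π([2]_* z) = 2·π'(z)`, `Sel^(2^(k+2)) ↠ Ш[2^(k+2)]`,
`ker π ⊆ [2]_* Sel^(2^(k+2))`). Levels `k = 1, 2`: `not_two_divisible_of_not_mem_range`,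
`X5.not_two_divisible_of_not_mem_selmer16`. [cite: SilvermanAEC2009, §X.4, Thm. X.4.2(a); Stamminger2005, §1.3] -/
theorem X5.not_two_divisible_of_not_mem_selmer_level {k : ℕ} {s : W.selmerGroup (2 ^ (k + 1) : ℕ)}
    (hs : ¬ ∃ z : W.selmerGroup (2 ^ (k + 2) : ℕ),
      W.selmerZSMul 2 (two_pow_succ_dvd_mul_two (k + 1)) z = s) :
    ¬ ∃ w : W.sha, 2 • w = W.selmerToSha _ s := by
  rintro ⟨w, hw⟩
  have hS : 2 ^ (k + 1) • W.selmerToSha _ s = 0 := by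
    have h := W.zsmul_selmerToSha ((2 ^ (k + 1) : ℕ) : ℤ) s
    rwa [Nat.cast_smul_eq_nsmul] at h
  have hS2 : ((2 ^ (k + 2) : ℕ) : ℤ) • w = 0 := by
    rw [Nat.cast_smul_eq_nsmul, two_pow_succ_smul, hw, hS]
  obtain ⟨z, hz⟩ := W.exists_selmerToSha_eq (n := ((2 ^ (k + 2) : ℕ) : ℤ)) (by positivity) w hS2
  have hz' : W.selmerToSha _ (s - W.selmerZSMul 2 (two_pow_succ_dvd_mul_two (k + 1)) z) = 0 := by
    rw [map_sub, selmerToSha_selmerZSMul, ofNat_zsmul, hz, hw, sub_self]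
  have hmn : ((2 ^ (k + 1) : ℕ) : ℤ) * 2 = ((2 ^ (k + 2) : ℕ) : ℤ) := by
    push_cast
    exact (pow_succ 2 (k + 1)).symm
  obtain ⟨z', hz''⟩ : ∃ z' : W.selmerGroup (2 ^ (k + 2) : ℕ),
      W.selmerZSMul 2 (two_pow_succ_dvd_mul_two (k + 1)) z' =
        s - W.selmerZSMul 2 (two_pow_succ_dvd_mul_two (k + 1)) z :=
    W.exists_selmerZSMul_eq_of_selmerToSha_eq_zero 2 hmn (by positivity) _ hz'
  exact hs ⟨z' + z, by rw [map_add, hz'', sub_add_cancel]⟩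

/-- **THE UNIFORM ITEM THEOREM over the tree's Selmer groups: `BSD(E, 2)` from ONE
`2^(k+1)`-Selmer class** (granted GZK and bsd.S18; nothing is claimed for any curve — `hs` is the
OPEN input on the rows no engine decides): analytic rank `≤ 1`; `#E(ℚ)[2] = 2^t`,
`#Sel^(2)(E/ℚ) = 2^(r_an+t+2)` (`#Ш[2] = 4`); every `2^k`-Selmer class lifts to `Sel^(2^(k+1))`
(`Ш[2^k] ⊆ 2Ш`); ONE `s ∈ Sel^(2^(k+1))(E/ℚ)` outside `[2]_* Sel^(2^(k+2))(E/ℚ)`;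
`ord₂ #Ш_an = 2(k+1)`. Levels `k = 1` (`X5.bsdp_two_of_selmer_item`, engines G / H) and `k = 2`
(`X5.bsdp_two_of_selmer_item₈`, the `#Ш_an = 64` rows) are its instances.
[cite: SilvermanAEC2009, Thm. X.4.2(a), Thm. X.4.14; Cassels1962ArithmeticIV, Thm. 1.1; Cassels1998, §1; Stamminger2005, Thm. 6.2.2] -/
theorem X5.bsdp_two_of_selmer_item_level {k : ℕ}
    (hGZK : rank_eq_analyticRank_of_analyticRank_le_one)
    (hCT : WeierstrassCurve.exists_casselsTate_pairing (K := ℚ)) (hr : W.analyticRank ≤ 1) {t : ℕ}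
    (ht : Nat.card (AddSubgroup.torsionBy W.toAffine.Point 2) = 2 ^ t)
    (hSel : Nat.card (W.selmerGroup 2) = 2 ^ (W.analyticRank + t + 2))
    (hF : ∀ s : W.selmerGroup (2 ^ k : ℕ), ∃ z : W.selmerGroup (2 ^ (k + 1) : ℕ),
      W.selmerZSMul 2 (two_pow_succ_dvd_mul_two k) z = s)
    {s : W.selmerGroup (2 ^ (k + 1) : ℕ)}
    (hs : ¬ ∃ z : W.selmerGroup (2 ^ (k + 2) : ℕ),
      W.selmerZSMul 2 (two_pow_succ_dvd_mul_two (k + 1)) z = s)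
    {q : ℚ} (hq : shaAn W = (q : ℂ)) (hv : padicValRat 2 q = ((2 * (k + 1) : ℕ) : ℤ)) :
    BSDp W 2 := by
  have h2 := X5.card_sha_two_of_card_selmerTwo W (hGZK W hr).1 ht hSel
  have hdiv := X5.two_divisible_of_selmer_lift_level W hF
  have hS : 2 ^ (k + 1) • W.selmerToSha _ s = 0 := by
    have h := W.zsmul_selmerToSha ((2 ^ (k + 1) : ℕ) : ℤ) s
    rwa [Nat.cast_smul_eq_nsmul] at h
  exact X5.bsdp_two_of_casselsTate_witness_level W hGZK hCT hr h2 hdiv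
    ⟨_, hS, X5.not_two_divisible_of_not_mem_selmer_level W hs⟩ hq hv

end Sha

end Literature.NumberTheory.EllipticCurves.Rank1Residual.Typed

end
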